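import Literature.NumberTheory.GaloisRepresentations.UnramifiedKummer
import Literature.NumberTheory.GaloisRepresentations.LocalGaloisGroupFrobeniusProofs
import Mathlib.RingTheory.DiscreteValuationRing.Basic
import Mathlib.FieldTheory.IsAlgClosed.Basic
import Mathlib.Algebra.Polynomial.Lifts
import HarnessLib

/-!
# The ring of integers `𝒪_{F_nr}` of the maximal unramified extension of a local field

Let `F` be a non-archimedean local field, `F̄ = AlgebraicClosure F`, `S = absIntegers 𝒪[F] F`
its valuation ring (`= {‖x‖ ≤ 1}`), `𝔓 = absMaximalIdeal F` (`= {‖x‖ < 1}`), `q = #𝓀[F]`, and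
`F_nr = maxUnramified F = F(μ_{p'}) ⊆ F̄` the maximal unramified extension (file
`UnramifiedKummer`: `e(F_nr/F) = 1`, `exists_algNorm_eq_zpow_of_mem_maxUnramified`, and
`I_F = Aut(F̄/F_nr)`, `mem_absInertia_iff_forall_mem_maxUnramified`).  This file sets up

* `Literature.NumberTheory.GaloisRepresentations.IsNonarchimedeanLocalField.maxUnramifiedIntegers F`
  — **`𝒪_{F_nr} = S ∩ F_nr`**, an `𝒪[F]`-subalgebra of `F̄`, with the `Gal(F̄/F)`-action
  (`smul_mem_maxUnramified`: `F_nr` is Galois-stable) on which the inertia group acts trivially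
  (`smul_eq_self_of_mem_absInertia`);
* it is a **discrete valuation ring with uniformiser `ϖ_F`** (`instIsDiscreteValuationRing`,
  `maximalIdeal_eq_span_uniformizer`): every non-zero element is `u ϖ_F ^ n` (units = norm `1`,
  `isUnit_iff_algNorm_eq_one`) — Serre, *Local Fields*, Ch. III §5, Thm. 2 and Cor. (`K_nr/K`
  unramified: `𝒪_{K_nr} = 𝒪_K ⊗ …`, same uniformiser);
* its **residue field is `S ⧸ 𝔓 = 𝓀̄`**: the reduction map `residueHom : 𝒪_{F_nr} → S ⧸ 𝔓` has
  kernel the maximal ideal and is onto (`residueHom_surjective`, Teichmüller representatives,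
  Serre, *Local Fields*, Ch. IV §4, Cor. 2 to Prop. 16: "the residue field of `K_nr` is `k̄`");
* **`S ⧸ 𝔓` is algebraically closed** (`isAlgClosed_quotient_absMaximalIdeal`: lift a monic
  polynomial to `S[X]`, take a root in `F̄`, it is integral) and **the fixed points of `x ↦ x^q`
  in `S ⧸ 𝔓` are `𝓀[F]`** (`mem_range_algebraMap_of_pow_residueFieldCard_eq`, root counting);
* an arithmetic Frobenius `σ₀` acts on `𝒪_{F_nr}` as `x ↦ x^q` modulo the maximal ideal
  (`IsAbsArithFrob.smul_sub_pow_mem_maximalIdeal`).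

These are the inputs of the completion `𝒪̂_{F_nr} = W(k̄) ⊗ 𝒪_F` and of Lang's theorem /
Hilbert 90 over `F̂_nr` (unramified `p`-adic representations are `F̂_nr`-admissible).
No named facts; definitions: `maxUnramifiedIntegers`, `residueHom` (+ the action instance).

## References

* [SerreLocalFields1979] J.-P. Serre, *Local Fields*, GTM 67 (1979), Ch. II §4 Prop. 8
  (multiplicative representatives), Ch. III §5 Thm. 2–3 (unramified extensions ↔ residue
  extensions), Ch. IV §4 Prop. 16, Cor. 1–2 (`K_nr = K(μ_{p'})`, residue field `k̄`).
* [NeukirchANT1999] J. Neukirch, *Algebraic Number Theory* (1999), Ch. II (7.5), §9.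
-/

noncomputable section

open ValuativeRel Field Polynomial
open scoped Pointwise

namespace Literature.NumberTheory.GaloisRepresentations
namespace IsNonarchimedeanLocalField

variable (F : Type*) [Field F] [ValuativeRel F] [TopologicalSpace F] [IsNonarchimedeanLocalField F]

/-! ### `F_nr` is Galois-stable -/

variable {F} in
omit [TopologicalSpace F] [IsNonarchimedeanLocalField F] in
/-- `F_nr = F(μ_{p'})` is stable under `Gal(F̄/F)` (roots of unity go to roots of unity of the same
order). [cite: SerreLocalFields1979, Ch. IV §4 Cor. 2 to Prop. 16] -/
theorem smul_mem_maxUnramified (σ : absoluteGaloisGroup F) {x : AlgebraicClosure F}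
    (hx : x ∈ maxUnramified F) : σ • x ∈ maxUnramified F := by
  refine IntermediateField.adjoin_induction (F := F) (s := primeToPRootsOfUnity F)
    (p := fun y _ => σ • y ∈ maxUnramified F) ?_ ?_ ?_ ?_ ?_ hx
  · rintro y ⟨N, hN, hyN⟩
    exact IntermediateField.subset_adjoin F _ ⟨N, hN, by rw [← smul_pow', hyN, smul_one]⟩
  · intro y
    rw [absoluteGaloisGroup.smul_def, AlgEquiv.commutes]
    exact IntermediateField.algebraMap_mem _ y
  · intro y w _ _ hy hw
    rw [smul_add]
    exact add_mem hy hw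
  · intro y _ hy
    rw [smul_inv'']
    exact inv_mem hy
  · intro y w _ _ hy hw
    rw [smul_mul']
    exact mul_mem hy hw

variable {F} in
omit [TopologicalSpace F] [IsNonarchimedeanLocalField F] in
/-- `S` is stable under `Gal(F̄/F)` (integrality is preserved by `F`-automorphisms). [folklore] -/
theorem smul_mem_absIntegers (σ : absoluteGaloisGroup F) {x : AlgebraicClosure F}
    (hx : x ∈ absIntegers 𝒪[F] F) : σ • x ∈ absIntegers 𝒪[F] F := by
  have h : IsIntegral 𝒪[F] x := hx
  have := h.map ((absoluteGaloisGroup.toAlgEquiv F σ).toAlgHom.restrictScalars 𝒪[F])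
  rw [absoluteGaloisGroup.smul_def]
  exact this

/-! ### The ring `𝒪_{F_nr} = S ∩ F_nr` -/

/-- **The ring of integers `𝒪_{F_nr}` of the maximal unramified extension** `F_nr = F(μ_{p'})`
of `F` inside `F̄`: the elements of `F_nr` of norm `≤ 1`, i.e. `S ∩ F_nr` with
`S = absIntegers 𝒪[F] F` the valuation ring of `F̄`, as an `𝒪[F]`-subalgebra of `F̄`.
It is a discrete valuation ring with uniformiser `ϖ_F` and residue field `k̄ = S ⧸ 𝔓`
(below).  Serre, *Local Fields*, Ch. III §5 and Ch. IV §4, Cor. 2 to Prop. 16.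
[cite: SerreLocalFields1979, Ch. IV §4 Cor. 2 to Prop. 16] -/
def maxUnramifiedIntegers : Subalgebra 𝒪[F] (AlgebraicClosure F) :=
  absIntegers 𝒪[F] F ⊓ (maxUnramified F).toSubalgebra.restrictScalars 𝒪[F]

variable {F}

omit [TopologicalSpace F] [IsNonarchimedeanLocalField F] in
/-- Membership in `𝒪_{F_nr}`: integral and in `F_nr`. [folklore] -/
theorem mem_maxUnramifiedIntegers_iff {x : AlgebraicClosure F} :
    x ∈ maxUnramifiedIntegers F ↔ x ∈ absIntegers 𝒪[F] F ∧ x ∈ maxUnramified F := by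
  rw [maxUnramifiedIntegers, Algebra.mem_inf, Subalgebra.mem_restrictScalars]
  rfl

omit [TopologicalSpace F] [IsNonarchimedeanLocalField F] in
/-- Elements of `𝒪_{F_nr}` are absolute integers. [folklore] -/
theorem mem_absIntegers_of_mem {x : AlgebraicClosure F} (hx : x ∈ maxUnramifiedIntegers F) :
    x ∈ absIntegers 𝒪[F] F :=
  (mem_maxUnramifiedIntegers_iff.1 hx).1

omit [TopologicalSpace F] [IsNonarchimedeanLocalField F] in
/-- Elements of `𝒪_{F_nr}` lie in `F_nr`. [folklore] -/
theorem mem_maxUnramified_of_mem {x : AlgebraicClosure F} (hx : x ∈ maxUnramifiedIntegers F) :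
    x ∈ maxUnramified F :=
  (mem_maxUnramifiedIntegers_iff.1 hx).2

/-- Elements of `𝒪_{F_nr}` have norm `≤ 1`. [folklore] -/
theorem algNorm_coe_maxUnramifiedIntegers_le_one (b : maxUnramifiedIntegers F) :
    algNorm F (b : AlgebraicClosure F) ≤ 1 :=
  mem_absIntegers_iff_algNorm_le_one.1 (mem_absIntegers_of_mem b.2)

/-- An element of `F_nr` of norm `≤ 1` lies in `𝒪_{F_nr}`. [folklore] -/
theorem mem_maxUnramifiedIntegers_of_algNorm_le_one {x : AlgebraicClosure F}
    (hx : x ∈ maxUnramified F) (h : algNorm F x ≤ 1) : x ∈ maxUnramifiedIntegers F :=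
  mem_maxUnramifiedIntegers_iff.2 ⟨mem_absIntegers_iff_algNorm_le_one.2 h, hx⟩

variable (F) in
/-- The inclusion `𝒪_{F_nr} → S` (an `𝒪[F]`-algebra map). [folklore] -/
def maxUnramifiedIntegers.toAbsIntegers : maxUnramifiedIntegers F →ₐ[𝒪[F]] absIntegers 𝒪[F] F :=
  Subalgebra.inclusion inf_le_left

omit [TopologicalSpace F] [IsNonarchimedeanLocalField F] in
/-- Unfolding lemma for the inclusion `𝒪_{F_nr} → S`. [folklore] -/
@[simp] theorem maxUnramifiedIntegers.coe_toAbsIntegers (b : maxUnramifiedIntegers F) :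
    ((maxUnramifiedIntegers.toAbsIntegers F b : absIntegers 𝒪[F] F) : AlgebraicClosure F) = b :=
  rfl

omit [TopologicalSpace F] [IsNonarchimedeanLocalField F] in
/-- The inclusion `𝒪_{F_nr} → S` is injective. [folklore] -/
theorem maxUnramifiedIntegers.toAbsIntegers_injective :
    Function.Injective (maxUnramifiedIntegers.toAbsIntegers F) :=
  Subalgebra.inclusion_injective _

omit [TopologicalSpace F] [IsNonarchimedeanLocalField F] in
/-- The image of `a ∈ 𝒪[F]` in `𝒪_{F_nr}`, as an element of `F̄`. [folklore] -/
@[simp] theorem coe_algebraMap_maxUnramifiedIntegers (a : 𝒪[F]) :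
    ((algebraMap 𝒪[F] (maxUnramifiedIntegers F) a : maxUnramifiedIntegers F) :
      AlgebraicClosure F) = algebraMap 𝒪[F] (AlgebraicClosure F) a :=
  rfl

omit [TopologicalSpace F] [IsNonarchimedeanLocalField F] in
/-- `𝒪[F] → 𝒪_{F_nr}` is injective. [folklore] -/
theorem algebraMap_maxUnramifiedIntegers_injective :
    Function.Injective (algebraMap 𝒪[F] (maxUnramifiedIntegers F)) := by
  intro a b h
  have h' := congrArg (fun z : maxUnramifiedIntegers F => (z : AlgebraicClosure F)) h
  simp only [coe_algebraMap_maxUnramifiedIntegers] at h'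
  rw [IsScalarTower.algebraMap_apply 𝒪[F] F (AlgebraicClosure F),
    IsScalarTower.algebraMap_apply 𝒪[F] F (AlgebraicClosure F)] at h'
  exact Subtype.val_injective ((algebraMap F (AlgebraicClosure F)).injective h')

/-! ### The Galois action on `𝒪_{F_nr}`; inertia acts trivially -/

/-- `Gal(F̄/F)` acts on `𝒪_{F_nr}` (both `S` and `F_nr` are Galois-stable) by ring
automorphisms.  Serre, *Local Fields*, Ch. IV §4. [cite: SerreLocalFields1979, Ch. IV §4 Cor. 2 to Prop. 16] -/
instance maxUnramifiedIntegers.instMulSemiringAction :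
    MulSemiringAction (absoluteGaloisGroup F) (maxUnramifiedIntegers F) where
  smul σ b := ⟨σ • (b : AlgebraicClosure F), mem_maxUnramifiedIntegers_iff.2
    ⟨smul_mem_absIntegers σ (mem_absIntegers_of_mem b.2),
      smul_mem_maxUnramified σ (mem_maxUnramified_of_mem b.2)⟩⟩
  one_smul b := Subtype.ext (one_smul _ (b : AlgebraicClosure F))
  mul_smul σ τ b := Subtype.ext (mul_smul σ τ (b : AlgebraicClosure F))
  smul_zero σ := Subtype.ext (smul_zero σ)
  smul_add σ a b := Subtype.ext (smul_add σ (a : AlgebraicClosure F) b)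
  smul_one σ := Subtype.ext (smul_one σ)
  smul_mul σ a b := Subtype.ext (smul_mul' σ (a : AlgebraicClosure F) b)

omit [TopologicalSpace F] [IsNonarchimedeanLocalField F] in
/-- Unfolding lemma for the action on `𝒪_{F_nr}`. [folklore] -/
@[simp] theorem maxUnramifiedIntegers.coe_smul (σ : absoluteGaloisGroup F)
    (b : maxUnramifiedIntegers F) :
    ((σ • b : maxUnramifiedIntegers F) : AlgebraicClosure F) = σ • (b : AlgebraicClosure F) :=
  rfl

omit [TopologicalSpace F] [IsNonarchimedeanLocalField F] in
/-- The action on `𝒪_{F_nr}` is compatible with the inclusion into `S`. [folklore] -/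
theorem maxUnramifiedIntegers.toAbsIntegers_smul (σ : absoluteGaloisGroup F)
    (b : maxUnramifiedIntegers F) :
    maxUnramifiedIntegers.toAbsIntegers F (σ • b) = σ • maxUnramifiedIntegers.toAbsIntegers F b :=
  Subtype.ext rfl

/-- The Galois action on `𝒪_{F_nr}` is `𝒪[F]`-linear. [folklore] -/
instance maxUnramifiedIntegers.instSMulCommClass :
    SMulCommClass (absoluteGaloisGroup F) 𝒪[F] (maxUnramifiedIntegers F) where
  smul_comm σ a b := Subtype.ext (by
    change σ • (a • (b : AlgebraicClosure F)) = a • σ • (b : AlgebraicClosure F)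
    exact smul_comm σ a (b : AlgebraicClosure F))

omit [TopologicalSpace F] [IsNonarchimedeanLocalField F] in
/-- `Gal(F̄/F)` fixes `𝒪[F] ⊆ 𝒪_{F_nr}` pointwise. [folklore] -/
@[simp] theorem maxUnramifiedIntegers.smul_algebraMap (σ : absoluteGaloisGroup F) (a : 𝒪[F]) :
    σ • algebraMap 𝒪[F] (maxUnramifiedIntegers F) a = algebraMap 𝒪[F] (maxUnramifiedIntegers F) a :=
  Subtype.ext (by
    rw [maxUnramifiedIntegers.coe_smul, coe_algebraMap_maxUnramifiedIntegers,
      IsScalarTower.algebraMap_apply 𝒪[F] F (AlgebraicClosure F), absoluteGaloisGroup.smul_def,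
      AlgEquiv.commutes])

/-- **The inertia group acts trivially on `𝒪_{F_nr}`** (`I_F = Aut(F̄/F_nr)`).
Serre, Invent. Math. 15 (1972), §1.2. [cite: SerreInventiones1972, §1.2] -/
theorem maxUnramifiedIntegers.smul_eq_self_of_mem_absInertia {σ : absoluteGaloisGroup F}
    (hσ : σ ∈ absInertia F) (b : maxUnramifiedIntegers F) : σ • b = b :=
  Subtype.ext (mem_absInertia_iff_forall_mem_maxUnramified.1 hσ _ (mem_maxUnramified_of_mem b.2))

/-! ### Norms, units and the discrete valuation -/

/-- A unit of `𝒪_{F_nr}` has norm `1`. [folklore] -/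
theorem algNorm_eq_one_of_isUnit {b : maxUnramifiedIntegers F} (hb : IsUnit b) :
    algNorm F (b : AlgebraicClosure F) = 1 := by
  obtain ⟨u, rfl⟩ := hb
  have h1 := algNorm_coe_maxUnramifiedIntegers_le_one (u : maxUnramifiedIntegers F)
  have h2 := algNorm_coe_maxUnramifiedIntegers_le_one ((u⁻¹ : (maxUnramifiedIntegers F)ˣ) :
    maxUnramifiedIntegers F)
  have h3 : algNorm F ((u : maxUnramifiedIntegers F) : AlgebraicClosure F) *
      algNorm F (((u⁻¹ : (maxUnramifiedIntegers F)ˣ) : maxUnramifiedIntegers F) :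
        AlgebraicClosure F) = 1 := by
    rw [← algNorm_mul, ← Subalgebra.coe_mul, ← Units.val_mul, mul_inv_cancel, Units.val_one,
      Subalgebra.coe_one, algNorm_one]
  by_contra h
  have hlt := lt_of_le_of_ne h1 h
  exact (mul_lt_one_of_nonneg_of_lt_one_left (algNorm_nonneg _) hlt h2).ne h3

/-- An element of `𝒪_{F_nr}` of norm `1` is a unit (its inverse lies in `F_nr` and has norm `1`).
[folklore] -/
theorem isUnit_of_algNorm_eq_one' {b : maxUnramifiedIntegers F}
    (hb : algNorm F (b : AlgebraicClosure F) = 1) : IsUnit b := by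
  have hb0 : (b : AlgebraicClosure F) ≠ 0 := by
    intro h; rw [h, algNorm_zero] at hb; exact zero_ne_one hb
  have hc : (b : AlgebraicClosure F)⁻¹ ∈ maxUnramifiedIntegers F :=
    mem_maxUnramifiedIntegers_of_algNorm_le_one (inv_mem (mem_maxUnramified_of_mem b.2))
      (by rw [algNorm_inv, hb, inv_one])
  refine IsUnit.of_mul_eq_one ⟨_, hc⟩ (Subtype.ext ?_)
  change (b : AlgebraicClosure F) * (b : AlgebraicClosure F)⁻¹ = 1
  exact mul_inv_cancel₀ hb0

/-- **Units of `𝒪_{F_nr}` are the elements of norm `1`.** [folklore] -/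
theorem isUnit_iff_algNorm_eq_one (b : maxUnramifiedIntegers F) :
    IsUnit b ↔ algNorm F (b : AlgebraicClosure F) = 1 :=
  ⟨algNorm_eq_one_of_isUnit, isUnit_of_algNorm_eq_one'⟩

/-- **`e(F_nr/F) = 1`**: a non-zero element of `𝒪_{F_nr}` has norm `‖ϖ_F‖ ^ n` with `n : ℕ`.
Serre, *Local Fields*, Ch. IV §4, Prop. 16 ("`K_n/K` is unramified").
[cite: SerreLocalFields1979, Ch. IV §4 Prop. 16] -/
theorem exists_algNorm_eq_pow {ϖ : 𝒪[F]} (hϖ : Irreducible ϖ) {b : maxUnramifiedIntegers F}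
    (hb : b ≠ 0) :
    ∃ n : ℕ, algNorm F (b : AlgebraicClosure F) =
      algNorm F (algebraMap 𝒪[F] (AlgebraicClosure F) ϖ) ^ n := by
  have hb0 : (b : AlgebraicClosure F) ≠ 0 := fun h => hb (Subtype.ext h)
  obtain ⟨z, hz⟩ := exists_algNorm_eq_zpow_of_mem_maxUnramified hϖ (mem_maxUnramified_of_mem b.2) hb0
  have hle : algNorm F (algebraMap 𝒪[F] (AlgebraicClosure F) ϖ) ^ z ≤ 1 :=
    hz ▸ algNorm_coe_maxUnramifiedIntegers_le_one b
  rw [zpow_le_one_iff_right_of_lt_one₀ (algNorm_uniformizer_pos hϖ)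
    (algNorm_uniformizer_lt_one hϖ)] at hle
  obtain ⟨n, rfl⟩ := Int.eq_ofNat_of_zero_le hle
  exact ⟨n, by rw [hz, zpow_natCast]⟩

/-- The image of a uniformiser of `𝒪[F]` is not a unit of `𝒪_{F_nr}`. [folklore] -/
theorem not_isUnit_algebraMap_uniformizer {ϖ : 𝒪[F]} (hϖ : Irreducible ϖ) :
    ¬ IsUnit (algebraMap 𝒪[F] (maxUnramifiedIntegers F) ϖ) := by
  rw [isUnit_iff_algNorm_eq_one, coe_algebraMap_maxUnramifiedIntegers]
  exact (algNorm_uniformizer_lt_one hϖ).ne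

/-- **Every non-zero element of `𝒪_{F_nr}` is a unit times a power of `ϖ_F`.**
Serre, *Local Fields*, Ch. III §5 (unramified: same uniformiser).
[cite: SerreLocalFields1979, Ch. IV §4 Prop. 16] -/
theorem exists_eq_unit_mul_pow {ϖ : 𝒪[F]} (hϖ : Irreducible ϖ) {b : maxUnramifiedIntegers F}
    (hb : b ≠ 0) :
    ∃ (n : ℕ) (u : (maxUnramifiedIntegers F)ˣ),
      b = u * algebraMap 𝒪[F] (maxUnramifiedIntegers F) ϖ ^ n := by
  obtain ⟨n, hn⟩ := exists_algNorm_eq_pow hϖ hb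
  set P : maxUnramifiedIntegers F := algebraMap 𝒪[F] (maxUnramifiedIntegers F) ϖ ^ n with hP
  have hP0 : (P : AlgebraicClosure F) ≠ 0 := by
    rw [hP, Subalgebra.coe_pow, coe_algebraMap_maxUnramifiedIntegers]
    exact pow_ne_zero _ (algNorm_pos_iff.1 (algNorm_uniformizer_pos hϖ))
  have hPnorm : algNorm F (P : AlgebraicClosure F) =
      algNorm F (algebraMap 𝒪[F] (AlgebraicClosure F) ϖ) ^ n := by
    rw [hP, Subalgebra.coe_pow, coe_algebraMap_maxUnramifiedIntegers, algNorm_pow]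
  -- `u = b / ϖ ^ n` has norm `1`
  have hu_mem : (b : AlgebraicClosure F) / P ∈ maxUnramifiedIntegers F :=
    mem_maxUnramifiedIntegers_of_algNorm_le_one
      (div_mem (mem_maxUnramified_of_mem b.2) (mem_maxUnramified_of_mem P.2))
      (by rw [algNorm_div, hn, hPnorm, div_self (pow_ne_zero _ (algNorm_uniformizer_pos hϖ).ne')])
  have hu1 : algNorm F (((⟨_, hu_mem⟩ : maxUnramifiedIntegers F) : AlgebraicClosure F)) = 1 := by
    change algNorm F ((b : AlgebraicClosure F) / P) = 1
    rw [algNorm_div, hn, hPnorm, div_self (pow_ne_zero _ (algNorm_uniformizer_pos hϖ).ne')]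
  obtain ⟨u, hu⟩ := isUnit_of_algNorm_eq_one' hu1
  refine ⟨n, u, Subtype.ext ?_⟩
  rw [Subalgebra.coe_mul, hu]
  change (b : AlgebraicClosure F) = (b : AlgebraicClosure F) / P * P
  rw [div_mul_cancel₀ _ hP0]

/-- The image of a uniformiser of `𝒪[F]` is irreducible in `𝒪_{F_nr}` (norms of a factorisation
are `‖ϖ‖ ^ a · ‖ϖ‖ ^ b` with `a + b = 1`). [cite: SerreLocalFields1979, Ch. IV §4 Prop. 16] -/
theorem irreducible_algebraMap_uniformizer {ϖ : 𝒪[F]} (hϖ : Irreducible ϖ) :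
    Irreducible (algebraMap 𝒪[F] (maxUnramifiedIntegers F) ϖ) := by
  refine ⟨not_isUnit_algebraMap_uniformizer hϖ, fun a b hab => ?_⟩
  have hϖ0 : algebraMap 𝒪[F] (maxUnramifiedIntegers F) ϖ ≠ 0 := fun h =>
    hϖ.ne_zero (algebraMap_maxUnramifiedIntegers_injective (by rw [h, map_zero]))
  have ha0 : a ≠ 0 := by rintro rfl; rw [zero_mul] at hab; exact hϖ0 hab
  have hb0 : b ≠ 0 := by rintro rfl; rw [mul_zero] at hab; exact hϖ0 hab
  obtain ⟨m, hm⟩ := exists_algNorm_eq_pow hϖ ha0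
  obtain ⟨n, hn⟩ := exists_algNorm_eq_pow hϖ hb0
  set c := algNorm F (algebraMap 𝒪[F] (AlgebraicClosure F) ϖ) with hc
  have hc0 : 0 < c := algNorm_uniformizer_pos hϖ
  have hc1 : c < 1 := algNorm_uniformizer_lt_one hϖ
  have hmn : c ^ (m + n) = c ^ 1 := by
    rw [pow_one, pow_add, ← hm, ← hn, ← algNorm_mul, ← Subalgebra.coe_mul, ← hab,
      coe_algebraMap_maxUnramifiedIntegers]
  have hsum : m + n = 1 := pow_right_injective₀ hc0 hc1.ne hmn
  rcases Nat.eq_zero_or_pos m with hm0 | hmpos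
  · left
    rw [hm0, pow_zero] at hm
    exact isUnit_of_algNorm_eq_one' hm
  · right
    have hn0 : n = 0 := by omega
    rw [hn0, pow_zero] at hn
    exact isUnit_of_algNorm_eq_one' hn

/-- **`𝒪_{F_nr}` is a discrete valuation ring** (with uniformiser `ϖ_F`).
Serre, *Local Fields*, Ch. III §5. [cite: SerreLocalFields1979, Ch. IV §4 Prop. 16] -/
instance maxUnramifiedIntegers.instIsDiscreteValuationRing :
    IsDiscreteValuationRing (maxUnramifiedIntegers F) := by
  obtain ⟨ϖ, hϖ⟩ := IsDiscreteValuationRing.exists_irreducible 𝒪[F]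
  refine IsDiscreteValuationRing.ofHasUnitMulPowIrreducibleFactorization
    ⟨algebraMap 𝒪[F] _ ϖ, irreducible_algebraMap_uniformizer hϖ, fun {x} hx => ?_⟩
  obtain ⟨n, u, hu⟩ := exists_eq_unit_mul_pow hϖ hx
  exact ⟨n, ⟨u, by rw [hu, mul_comm]⟩⟩

/-- **The maximal ideal of `𝒪_{F_nr}` is generated by `ϖ_F`** (`e = 1`).
[cite: SerreLocalFields1979, Ch. IV §4 Prop. 16] -/
theorem maximalIdeal_eq_span_uniformizer {ϖ : 𝒪[F]} (hϖ : Irreducible ϖ) :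
    IsLocalRing.maximalIdeal (maxUnramifiedIntegers F) =
      Ideal.span {algebraMap 𝒪[F] (maxUnramifiedIntegers F) ϖ} :=
  (IsDiscreteValuationRing.irreducible_iff_uniformizer _).1 (irreducible_algebraMap_uniformizer hϖ)

/-- Membership in the maximal ideal of `𝒪_{F_nr}`: norm `< 1`. [folklore] -/
theorem mem_maximalIdeal_iff_algNorm_lt_one {b : maxUnramifiedIntegers F} :
    b ∈ IsLocalRing.maximalIdeal (maxUnramifiedIntegers F) ↔ algNorm F (b : AlgebraicClosure F) < 1 := by
  rw [IsLocalRing.mem_maximalIdeal, mem_nonunits_iff, isUnit_iff_algNorm_eq_one]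
  exact ⟨fun h => lt_of_le_of_ne (algNorm_coe_maxUnramifiedIntegers_le_one b) h, fun h => h.ne⟩

/-- The maximal ideal of `𝒪_{F_nr}` is the pull-back of `𝔓`. [folklore] -/
theorem maximalIdeal_eq_comap_absMaximalIdeal :
    IsLocalRing.maximalIdeal (maxUnramifiedIntegers F) =
      (absMaximalIdeal F).comap (maxUnramifiedIntegers.toAbsIntegers F) := by
  ext b
  rw [mem_maximalIdeal_iff_algNorm_lt_one, Ideal.mem_comap, mem_absMaximalIdeal_iff_algNorm_lt_one]
  rfl

/-- The maximal ideal of `𝒪_{F_nr}` is `Gal(F̄/F)`-stable. [folklore] -/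
theorem smul_mem_maximalIdeal (σ : absoluteGaloisGroup F) {b : maxUnramifiedIntegers F}
    (hb : b ∈ IsLocalRing.maximalIdeal (maxUnramifiedIntegers F)) :
    σ • b ∈ IsLocalRing.maximalIdeal (maxUnramifiedIntegers F) := by
  rw [mem_maximalIdeal_iff_algNorm_lt_one] at hb ⊢
  rw [maxUnramifiedIntegers.coe_smul, algNorm_smul]
  exact hb

/-! ### The residue field of `𝒪_{F_nr}` is `S ⧸ 𝔓` -/

variable (F) in
/-- **Reduction modulo `𝔓`**: `𝒪_{F_nr} → S → S ⧸ 𝔓`. Its kernel is the maximal ideal and it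
is surjective (Teichmüller representatives), so the residue field of `F_nr` is `k̄ = S ⧸ 𝔓`.
Serre, *Local Fields*, Ch. IV §4, Cor. 2 to Prop. 16. [cite: SerreLocalFields1979, Ch. IV §4 Cor. 2 to Prop. 16] -/
def maxUnramifiedIntegers.residueHom :
    maxUnramifiedIntegers F →+* absIntegers 𝒪[F] F ⧸ absMaximalIdeal F :=
  (Ideal.Quotient.mk (absMaximalIdeal F)).comp (maxUnramifiedIntegers.toAbsIntegers F).toRingHom

/-- Unfolding lemma for `residueHom`. [folklore] -/
theorem maxUnramifiedIntegers.residueHom_apply (b : maxUnramifiedIntegers F) :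
    maxUnramifiedIntegers.residueHom F b =
      Ideal.Quotient.mk (absMaximalIdeal F) (maxUnramifiedIntegers.toAbsIntegers F b) := rfl

/-- `residueHom b` is the total residue map `residue F` applied to `b`. [folklore] -/
theorem maxUnramifiedIntegers.residueHom_eq_residue (b : maxUnramifiedIntegers F) :
    maxUnramifiedIntegers.residueHom F b = residue F (b : AlgebraicClosure F) := by
  rw [maxUnramifiedIntegers.residueHom_apply, ← residue_coe]
  rfl

/-- `residueHom` on `𝒪[F]` is the residue embedding `𝓀[F] → S ⧸ 𝔓`. [folklore] -/
theorem maxUnramifiedIntegers.residueHom_algebraMap (a : 𝒪[F]) :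
    maxUnramifiedIntegers.residueHom F (algebraMap 𝒪[F] (maxUnramifiedIntegers F) a) =
      algebraMap 𝓀[F] (absIntegers 𝒪[F] F ⧸ absMaximalIdeal F) (IsLocalRing.residue 𝒪[F] a) := by
  rw [maxUnramifiedIntegers.residueHom_apply, AlgHom.commutes]
  rfl

/-- **The kernel of the reduction map is the maximal ideal of `𝒪_{F_nr}`.** [folklore] -/
theorem maxUnramifiedIntegers.ker_residueHom :
    RingHom.ker (maxUnramifiedIntegers.residueHom F) =
      IsLocalRing.maximalIdeal (maxUnramifiedIntegers F) := by
  ext b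
  rw [RingHom.mem_ker, maxUnramifiedIntegers.residueHom_apply, Ideal.Quotient.eq_zero_iff_mem,
    maximalIdeal_eq_comap_absMaximalIdeal, Ideal.mem_comap]

/-- **The reduction map `𝒪_{F_nr} → S ⧸ 𝔓` is surjective**: every element of `S ∖ 𝔓` is congruent
to a root of unity of order prime to `p` (`exists_rootOfUnity_sub_mem_absMaximalIdeal`), which
lies in `F_nr = F(μ_{p'})`.  Serre, *Local Fields*, Ch. IV §4, Cor. 2 to Prop. 16 ("the residue
field of `K_nr` is the algebraic closure of `k`"). [cite: SerreLocalFields1979, Ch. IV §4 Cor. 2 to Prop. 16] -/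
theorem maxUnramifiedIntegers.residueHom_surjective :
    Function.Surjective (maxUnramifiedIntegers.residueHom F) := by
  intro y
  obtain ⟨b, rfl⟩ := Ideal.Quotient.mk_surjective y
  by_cases hb : b ∈ absMaximalIdeal F
  · exact ⟨0, by rw [map_zero, eq_comm, Ideal.Quotient.eq_zero_iff_mem]; exact hb⟩
  · obtain ⟨N, ζ, hN, hζN, hbζ⟩ := exists_rootOfUnity_sub_mem_absMaximalIdeal hb
    have hζnr : (ζ : AlgebraicClosure F) ∈ maxUnramified F :=
      IntermediateField.subset_adjoin F _ ⟨N, hN, by rw [← Subalgebra.coe_pow, hζN, Subalgebra.coe_one]⟩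
    refine ⟨⟨ζ, mem_maxUnramifiedIntegers_iff.2 ⟨ζ.2, hζnr⟩⟩, ?_⟩
    rw [maxUnramifiedIntegers.residueHom_apply, eq_comm, Ideal.Quotient.eq]
    exact hbζ

/-- The residue map `𝒪_{F_nr} → S ⧸ 𝔓` is `Gal(F̄/F)`-compatible with an arithmetic Frobenius:
**an arithmetic Frobenius `σ₀` acts on `𝒪_{F_nr}` as `x ↦ x ^ q` modulo the maximal ideal**.
Serre, *Local Fields*, Ch. I §8. [cite: TateCorvallis1979, §1.4 (1.4.1)] -/
theorem IsAbsArithFrob.smul_sub_pow_mem_maximalIdeal {σ : absoluteGaloisGroup F}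
    (hσ : IsAbsArithFrob σ) (b : maxUnramifiedIntegers F) :
    σ • b - b ^ residueFieldCard F ∈ IsLocalRing.maximalIdeal (maxUnramifiedIntegers F) := by
  rw [maximalIdeal_eq_comap_absMaximalIdeal, Ideal.mem_comap, map_sub, map_pow,
    maxUnramifiedIntegers.toAbsIntegers_smul]
  exact isAbsArithFrob_iff_holds.1 hσ _

/-- Frobenius on residues: `σ₀ b ≡ b ^ q` in `S ⧸ 𝔓`. [cite: TateCorvallis1979, §1.4 (1.4.1)] -/
theorem IsAbsArithFrob.residueHom_smul {σ : absoluteGaloisGroup F} (hσ : IsAbsArithFrob σ)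
    (b : maxUnramifiedIntegers F) :
    maxUnramifiedIntegers.residueHom F (σ • b) =
      maxUnramifiedIntegers.residueHom F b ^ residueFieldCard F := by
  rw [← map_pow, ← sub_eq_zero, ← map_sub, ← RingHom.mem_ker,
    maxUnramifiedIntegers.ker_residueHom]
  exact IsAbsArithFrob.smul_sub_pow_mem_maximalIdeal hσ b

/-- Elements of the inertia group act trivially on residues (indeed on `𝒪_{F_nr}`). [folklore] -/
theorem maxUnramifiedIntegers.residueHom_smul_of_mem_absInertia {σ : absoluteGaloisGroup F}
    (hσ : σ ∈ absInertia F) (b : maxUnramifiedIntegers F) :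
    maxUnramifiedIntegers.residueHom F (σ • b) = maxUnramifiedIntegers.residueHom F b := by
  rw [maxUnramifiedIntegers.smul_eq_self_of_mem_absInertia hσ]

/-! ### `S ⧸ 𝔓` is algebraically closed; its Frobenius-fixed points are `𝓀[F]` -/

section ResidueField

attribute [local instance] Ideal.Quotient.field

variable (F) in
/-- **The residue field `S ⧸ 𝔓` of `F̄` is algebraically closed**: a monic polynomial over
`S ⧸ 𝔓` lifts to a monic polynomial over `S`, which has a root in the algebraically closed field
`F̄`; the root is integral over `S`, hence over `𝒪[F]`, i.e. lies in `S`, and reduces to a root.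
Serre, *Local Fields*, Ch. IV §4, Cor. 2 to Prop. 16. [cite: SerreLocalFields1979, Ch. IV §4 Cor. 2 to Prop. 16] -/
theorem isAlgClosed_quotient_absMaximalIdeal :
    IsAlgClosed (absIntegers 𝒪[F] F ⧸ absMaximalIdeal F) := by
  refine IsAlgClosed.of_exists_root _ fun p hp hirr => ?_
  set π := Ideal.Quotient.mk (absMaximalIdeal F) with hπ
  have hlifts : p ∈ Polynomial.lifts π := by
    rw [Polynomial.lifts_iff_coeff_lifts]
    intro n
    exact Ideal.Quotient.mk_surjective (p.coeff n)
  obtain ⟨P, hPp, hPdeg, hPmonic⟩ := Polynomial.lifts_and_degree_eq_and_monic hlifts hp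
  -- a root of `P` in `F̄`
  set Pbar : (AlgebraicClosure F)[X] :=
    P.map (algebraMap (absIntegers 𝒪[F] F) (AlgebraicClosure F)) with hPbar
  have hPbar_monic : Pbar.Monic := hPmonic.map _
  have hdegp : p.degree ≠ 0 :=
    (Polynomial.degree_pos_of_ne_zero_of_nonunit hirr.ne_zero hirr.not_isUnit).ne'
  have hdegPbar : Pbar.degree ≠ 0 := by
    rw [hPbar, hPmonic.degree_map, hPdeg]
    exact hdegp
  obtain ⟨α, hα⟩ := IsAlgClosed.exists_root Pbar hdegPbar
  -- `α` is integral over `S`, hence lies in `S`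
  have hαS : IsIntegral (absIntegers 𝒪[F] F) α := ⟨P, hPmonic, by
    rw [← Polynomial.eval_map]; exact hα⟩
  have hαmem : α ∈ absIntegers 𝒪[F] F := (mem_integralClosure_iff _ _).2 (isIntegral_trans α hαS)
  set a : absIntegers 𝒪[F] F := ⟨α, hαmem⟩ with ha
  refine ⟨π a, ?_⟩
  -- `P(a) = 0` in `S`, then reduce modulo `𝔓`
  have hPα : P.eval a = 0 := by
    apply Subtype.val_injective
    have h1 : ((P.eval a : absIntegers 𝒪[F] F) : AlgebraicClosure F) =
        (P.map (algebraMap (absIntegers 𝒪[F] F) (AlgebraicClosure F))).eval α := by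
      rw [Polynomial.eval_map, ← Polynomial.coe_aeval_eq_eval, ← Polynomial.aeval_def]
      exact (Polynomial.aeval_algebraMap_apply (AlgebraicClosure F) a P).symm
    rw [h1]
    exact hα
  rw [← hPp, Polynomial.eval_map, Polynomial.eval₂_hom, hPα, map_zero]

/-- **The fixed points of `x ↦ x ^ q` in `S ⧸ 𝔓` are the elements of `𝓀[F]`**: the `q`
elements of `𝓀[F] ⊆ S ⧸ 𝔓` are roots of `X ^ q - X`, which has at most `q` roots.
Serre, *Local Fields*, Ch. IV §4 (Gal(`k̄/k`) and Frobenius). [folklore] -/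
theorem mem_range_algebraMap_of_pow_residueFieldCard_eq
    {y : absIntegers 𝒪[F] F ⧸ absMaximalIdeal F} (hy : y ^ residueFieldCard F = y) :
    y ∈ Set.range (algebraMap 𝓀[F] (absIntegers 𝒪[F] F ⧸ absMaximalIdeal F)) := by
  classical
  letI : Fintype 𝓀[F] := Fintype.ofFinite 𝓀[F]
  have hq1 : 1 < residueFieldCard F := one_lt_residueFieldCard F
  have hqcard : Fintype.card 𝓀[F] = residueFieldCard F := by
    rw [residueFieldCard, Nat.card_eq_fintype_card]
  let f : (absIntegers 𝒪[F] F ⧸ absMaximalIdeal F)[X] := X ^ residueFieldCard F - X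
  have hf0 : f ≠ 0 := FiniteField.X_pow_card_sub_X_ne_zero _ hq1
  have hfdeg : f.natDegree = residueFieldCard F := FiniteField.X_pow_card_sub_X_natDegree_eq _ hq1
  have hroot : ∀ z, z ∈ f.roots.toFinset ↔ z ^ residueFieldCard F = z := fun z => by
    rw [Multiset.mem_toFinset, Polynomial.mem_roots hf0, Polynomial.IsRoot.def, eval_sub, eval_pow,
      eval_X, sub_eq_zero]
  have hTcard : f.roots.toFinset.card ≤ residueFieldCard F :=
    hfdeg ▸ (Multiset.toFinset_card_le _).trans (Polynomial.card_roots' f)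
  let ι := algebraMap 𝓀[F] (absIntegers 𝒪[F] F ⧸ absMaximalIdeal F)
  have hIcard : (Finset.univ.image ι).card = residueFieldCard F := by
    rw [Finset.card_image_of_injective _ ι.injective, Finset.card_univ, hqcard]
  have hIT : Finset.univ.image ι ⊆ f.roots.toFinset := by
    intro z hz
    obtain ⟨a, -, rfl⟩ := Finset.mem_image.1 hz
    rw [hroot, ← map_pow, ← hqcard, FiniteField.pow_card]
  have hIeqT : Finset.univ.image ι = f.roots.toFinset :=
    Finset.eq_of_subset_of_card_le hIT (by rw [hIcard]; exact hTcard)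
  have hyT : y ∈ f.roots.toFinset := (hroot y).2 hy
  rw [← hIeqT, Finset.mem_image] at hyT
  obtain ⟨a, -, ha⟩ := hyT
  exact ⟨a, ha⟩

end ResidueField

end IsNonarchimedeanLocalField
end Literature.NumberTheory.GaloisRepresentations

end
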